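import Summits.BirchSwinnertonDyer.BirchSwinnertonDyer.Theorems.SemiOrdinaryEisensteinDescentWildSplitEisensteinValueAtOneVStepLNormalForm
import Summits.BirchSwinnertonDyer.BirchSwinnertonDyer.Theorems.UniversalToricDescentWildSplitControlAtThreeOfPoitouTate
import HarnessLib

/-!
# Route `SemiOrdinaryEisensteinDescent`, crux #2″ `WildSplitEisensteinValueAtOneV` (`E_𝟙^V`, stmt-BirchSwinnertonDyer-26610):
# NECESSITY and the rung-equivalence of the crux MODULO PRINT ONLY — the aside crux C (20386) leaves every certificate
# (cell `pub/bsd-wall`, width seat `bsd-wall-soed-p1-w3` g14, `--supports stmt-BirchSwinnertonDyer-26610`, helper)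

WHY. The item text of crux #2″ says «NECESSARY for the rung: leaf ⟹ `E_𝟙^V` (… given print) … so it is the weakest crux that
can sit in this slot and a refutation of it refutes the rung itself». The two kernel certificates of that sentence on record,
w2 g4's `WildSplitEisensteinInclusionAtThreeTight.valueAtOneV_of_wAllExclAddWildRankOneSurj` (p591437 §3) and w3 g13's
`WildSplitEisensteinValueAtOneVStepLNormalForm.valueAtOneV_of_stepL_of_control` / `valueAtOneV_iff_stepL` (p615634 §2–§3), both
take the control EQUALITY C = `WildSplitControlAtThree` (item 20386, an ASIDE CRUX of this route, rank 5) as a hypothesis —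
so, as certified, «refuting `E_𝟙^V` refutes the rung» held modulo an open crux, not modulo print. But C is PRINT-CLOSED in the
tree: route `UniversalToricDescent` carries the SAME item 20386 (the two route files render byte-identical texts), split there
into seven published-fact leaves, five of which are tree theorems, leaving exactly the two Poitou–Tate facts
(`UniversalToricDescentControl.wildSplitControlAtThree_of_poitouTate`, utd-p3 g5: PT1 = Poitou–Tate duality for Selmer
structures, Milne ADT I 4.10(b) — already an SOED binder, item 20461 — and PT2 = `Ш¹(T) ≃ Ш²(T^D)^∨`, Milne ADT I 4.10(a)/
Tate, UTD item 20462, Literature fact `poitouTate_sha_tateDual`, taken here BY ITS UTD ITEM NAME `Theses.UniversalToricDescent.PoitouTateShaTateDualFact`). This file threads that closer through the SOED certificates: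

* §1 `wildSplitControlAtThree_of_poitouTate` — C under its SOED name ⟸ PT1 + PT2 (the UTD theorem, transported along the
  identical text).
* §2 `valueAtOneV_of_stepL_of_poitouTate` — **`L₃ʷ°` → Kolyvagin → PT1 → PT2 → `E_𝟙^V` (BY NAME)** (p615634 §2 with C
  discharged), and §3 `valueAtOneV_iff_stepL_of_print` — **modulo {Kolyvagin, W 24476, PT1, PT2} — four PRINT packages, no
  crux — `E_𝟙^V ⟺ L₃ʷ°`** (`L₃ʷ°` = `SchneiderFree.IndexLowerBoundLeAt W 3 K P (v₃ c)` on the odd Friedberg–Hoffstein data,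
  displayed).
* §4 `valueAtOneV_of_wAllExclAddWildRankOneSurj_of_poitouTate` — **leaf → PUB → PT1 → PT2 → Z → `E_𝟙^V` (BY NAME)**: the
  necessity sentence of the item text, certified modulo print + the rank-zero leaf Z (which the rung needs anyway).
* §5 `wAllExclAddWildRankOneSurj_iff_valueAtOneV_of_binders` — **modulo the CURRENT `closes` binders of the route taken at
  face value {PUB 20389, Prims 25896, Jetchev max-form 25897, `J‴` 25898, W 24476, PT1 20461, Z 20387} plus PT2:
  `WAllExclAddWildRankOneSurj ⟺ E_𝟙^V`** (⇐ is the landed kernel-V closer p613203 by name; ⇒ is §4). So crux #2″ is EXACTLY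
  the residual of the rung given the Kolyvagin column and print: neither weaker nor stronger.
* §6 `stepL_of_wAllExclAddWildRankOneSurj` / `wAllExclAddWildRankOneSurj_iff_stepL_of_binders` — the same pair in INDEX
  currency: leaf → PUB → Z → `L₃ʷ°`, and **modulo {PUB, Prims, Jetchev max-form, `J‴`, PT1, Z}: leaf ⟺ `L₃ʷ°`** (⇐ = the
  `W`-free kernel p615634 §4). Reading for the pen's option G′-L: in index currency the rung-equivalence certificate uses
  NEITHER W (Hsieh Thm A ∧ BDP 5.5 ∧ LZZ) NOR PT2 NOR any frame; in `E_𝟙^V` currency it uses W + PT2 (both directions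
  pass through the control theorem at `𝔭′`). The difference of trust bases between the two typings of crux #2 is therefore
  exactly {W 24476, PT2, the odd frame 24475 ✓}; the research content is identical (§3).

HONEST FRAMING: bookkeeping, CONDITIONAL on every displayed antecedent. `E_𝟙^V` / `L₃ʷ°` (the «≥» half of the `3`-part of
`#Ш(E/K)` in Heegner-index currency on the onto wild `r = 1` cell; no Eisenstein or indivisibility engine at an additive
potentially supersingular `3` in print), `J‴` and Z are research-open; PUB, Prims, the Jetchev max-form, W, PT1, PT2,
Kolyvagin are print. No crux is claimed false; nothing is asserted about any curve; closes nothing; BSD₃ is proved for no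
curve by this file. No definition, no named fact, no `sorry`.

References: [JetchevSkinnerWan2017] Thm. 3.3.1, Prop. 3.3.4, §7.4.1 (arXiv:1512.06894 pp. 11–13, 30); [MilneADT2006] I Thm. 2.8,
Thm. 4.10; [Brink2007] Thm. 2, Cor. 1; [Serre1967GroupesPDivisibles] §5 Prop. 8; [GrossZagier1986] I.(6.3), (7.3), V §2;
[FriedbergHoffstein1995] Thm. B; [Kolyvagin1990] Thm. A; [Castella2018] Thm. 2.3, §5; [McCallumLMS1991] §3; [GrossLMS1991]
Prop. 3.7(2), §6; [Jetchev2008] Thm. 1.4.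
-/

noncomputable section

open scoped Classical NumberField

set_option linter.dupNamespace false -- `Summit.BirchSwinnertonDyer.BirchSwinnertonDyer.Theorems.…` (summit = sub, D-0017)
set_option autoImplicit false

namespace Summit.BirchSwinnertonDyer.BirchSwinnertonDyer.Theorems.WildSplitEisensteinValueAtOneVNecessityOfPrint

open WeierstrassCurve NumberField IsDedekindDomain Field PowerSeries
  Literature.NumberTheory.EllipticCurves
  Literature.NumberTheory.EllipticCurves.ModularForms
  Literature.NumberTheory.EllipticCurves.Rank1Residual
  Literature.NumberTheory.EllipticCurves.KrizLi2019
  Literature.NumberTheory.GaloisCohomology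
  Summit.BirchSwinnertonDyer.Rank1Residual
  Summit.BirchSwinnertonDyer.Rank1Residual.Additive
  Summit.BirchSwinnertonDyer.Rank1Residual.X11b
  Summit.BirchSwinnertonDyer.Rank1Residual.X11b.AcSelmer
  Summit.BirchSwinnertonDyer.Rank1Residual.X11b.Halves
  Summit.BirchSwinnertonDyer.BirchSwinnertonDyer.Theses.SemiOrdinaryEisensteinDescent
  Summit.BirchSwinnertonDyer.BirchSwinnertonDyer.Theorems

/-! ### §1 The aside crux C under its SOED name is print-closed modulo the two Poitou–Tate facts -/

/-- **C ⟸ PT1 + PT2 (SOED name).** Item 20386 `WildSplitControlAtThree` — Jetchev–Skinner–Wan's anticyclotomic control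
count at the potentially supersingular split `3` — follows from Poitou–Tate duality for Selmer structures (PT1, item 20461)
and for `Ш` (PT2, `poitouTate_sha_tateDual`): utd-p3 g5's `UniversalToricDescentControl.wildSplitControlAtThree_of_poitouTate`
(local Euler–Poincaré, `cd ≤ 2`, Brink Thm 2 / Cor 1 and Serre 1967 §5 Prop. 8 are tree theorems there), transported along the
byte-identical texts of the two route copies of the item. CONDITIONAL on the two named facts.
[cite: JetchevSkinnerWan2017, Thm. 3.3.1 and Prop. 3.3.4 (arXiv:1512.06894 pp. 11–13)] [cite: MilneADT2006, Ch. I, Thm. 4.10]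
[cite: Serre1967GroupesPDivisibles, §5 Prop. 8] -/
theorem wildSplitControlAtThree_of_poitouTate (hPT : PoitouTateSelmerStructureDualityFact)
    (hPT2 : Theses.UniversalToricDescent.PoitouTateShaTateDualFact) : WildSplitControlAtThree := by
  intro W
  exact UniversalToricDescentControl.wildSplitControlAtThree_of_poitouTate hPT (fun K _ _ ↦ hPT2 K) W

/-! ### §2–§3 `L₃ʷ° ⟹ E_𝟙^V` and `E_𝟙^V ⟺ L₃ʷ°` modulo PRINT only -/

/-- **`L₃ʷ° → Kolyvagin → PT1 → PT2 → E_𝟙^V` (BY NAME).** w3 g13's `valueAtOneV_of_stepL_of_control` (p615634 §2) with its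
aside-crux hypothesis C discharged by §1: the STEP-L socket at the Manin slack on the odd Friedberg–Hoffstein data (displayed
hypothesis `hL`), Kolyvagin's finiteness, and Poitou–Tate duality (for Selmer structures and for `Ш`) give the crux
`WildSplitEisensteinValueAtOneV`. CONDITIONAL; nothing asserted about any curve.
[cite: JetchevSkinnerWan2017, Thm. 3.3.1 and §7.4.1 (arXiv:1512.06894 pp. 11, 30)] [cite: Castella2018, Thm. 2.3 and §5 (5.1)–(5.3)]
[cite: MilneADT2006, Ch. I, Thm. 4.10] -/
theorem valueAtOneV_of_stepL_of_poitouTate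
    (hL : ∀ (W : WeierstrassCurve ℚ) [W.IsElliptic] [W.IsGloballyMinimal] (N : ℕ) [NeZero N] (K : Type) [Field K]
      [NumberField K] (Dt : ModularParametrizationData W N) (H : HeegnerDatum N (NumberField.discr K)) (ι : K →+* ℂ)
      (P : (W.baseChange K).toAffine.Point), ClassO6 W 3 → W.HasSurjectiveModNGaloisRep 3 → W.analyticRank = 1 →
      W.conductorNorm ℤ = N → IsImaginaryQuadratic K → SatisfiesHeegnerHypothesis N K →
      (W.quadraticTwist (NumberField.discr K : ℚ)).entireLFunction 1 ≠ 0 →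
      WeierstrassCurve.Affine.Point.map ι.toRatAlgHom P = heegnerPointComplex Dt H → ¬ IsOfFinAddOrder P →
      Odd (NumberField.discr K) → SchneiderFree.IndexLowerBoundLeAt W 3 K P (padicValNat 3 Dt.c.natAbs))
    (hKo : ∀ (N : ℕ) [NeZero N] (W : WeierstrassCurve ℚ) (K : Type) [Field K] [NumberField K],
      Literature.NumberTheory.EllipticCurves.kolyvagin N W K)
    (hPT : PoitouTateSelmerStructureDualityFact)
    (hPT2 : Theses.UniversalToricDescent.PoitouTateShaTateDualFact) : WildSplitEisensteinValueAtOneV :=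
  WildSplitEisensteinValueAtOneVStepLNormalForm.valueAtOneV_of_stepL_of_control hL hKo
    (wildSplitControlAtThree_of_poitouTate hPT hPT2)

/-- **Normal form modulo PRINT: granted {Kolyvagin, W 24476, PT1 20461, PT2}, `E_𝟙^V ⟺ L₃ʷ°`** — p615634 §3 with the aside
crux C replaced by the two Poitou–Tate facts. All four packages are published theorems taken by name; no crux of the route
is a hypothesis. CONDITIONAL bookkeeping. [cite: JetchevSkinnerWan2017, Thm. 3.3.1 and §7.4.1 (arXiv:1512.06894 pp. 11, 30)]
[cite: MilneADT2006, Ch. I, Thm. 4.10] -/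
theorem valueAtOneV_iff_stepL_of_print
    (hKo : ∀ (N : ℕ) [NeZero N] (W : WeierstrassCurve ℚ) (K : Type) [Field K] [NumberField K],
      Literature.NumberTheory.EllipticCurves.kolyvagin N W K)
    (hW : WildSplitPrintedInputsAtThree) (hPT : PoitouTateSelmerStructureDualityFact)
    (hPT2 : Theses.UniversalToricDescent.PoitouTateShaTateDualFact) :
    WildSplitEisensteinValueAtOneV ↔
      ∀ (W : WeierstrassCurve ℚ) [W.IsElliptic] [W.IsGloballyMinimal] (N : ℕ) [NeZero N] (K : Type) [Field K]
        [NumberField K] (Dt : ModularParametrizationData W N) (H : HeegnerDatum N (NumberField.discr K)) (ι : K →+* ℂ)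
        (P : (W.baseChange K).toAffine.Point), ClassO6 W 3 → W.HasSurjectiveModNGaloisRep 3 → W.analyticRank = 1 →
        W.conductorNorm ℤ = N → IsImaginaryQuadratic K → SatisfiesHeegnerHypothesis N K →
        (W.quadraticTwist (NumberField.discr K : ℚ)).entireLFunction 1 ≠ 0 →
        WeierstrassCurve.Affine.Point.map ι.toRatAlgHom P = heegnerPointComplex Dt H → ¬ IsOfFinAddOrder P →
        Odd (NumberField.discr K) → SchneiderFree.IndexLowerBoundLeAt W 3 K P (padicValNat 3 Dt.c.natAbs) :=
  ⟨fun hE1V ↦ WildSplitEisensteinValueAtOneVStepLNormalForm.stepL_of_valueAtOneV hE1V hKo hW hPT,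
    fun hL ↦ valueAtOneV_of_stepL_of_poitouTate hL hKo hPT hPT2⟩

/-! ### §4 Necessity for the rung modulo print: leaf → PUB → PT1 → PT2 → Z → `E_𝟙^V` -/

/-- **The necessity sentence of the item text, modulo PRINT: `PublishedInputsWildThree → PT1 → PT2 → WildRankZeroTwistAtThree →
WAllExclAddWildRankOneSurj → E_𝟙^V` (BY NAME).** w2 g4's `Tight.valueAtOneV_of_wAllExclAddWildRankOneSurj` (leaf + Z ⟹ both
`BSD₃`'s ⟹ the STEP-L socket ⟹ with the control count at `𝔭′` ⟹ the norm inequality) with its hypothesis C discharged by §1.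
The rank-zero leaf Z is the rung's own binder (the twist `E^{(d_K)}` is an O6 row of analytic rank `0`); everything else is
print. So a refutation of `E_𝟙^V` refutes `WAllExclAddWildRankOneSurj ∧ Z` — i.e. BSD₃ on the wild O6 rows — given print.
CONDITIONAL; nothing asserted about any curve. [cite: JetchevSkinnerWan2017, §7.4.1 (arXiv:1512.06894 p. 30)]
[cite: GrossZagier1986, Thm. I.(6.3) and (7.3)] [cite: MilneADT2006, Ch. I, Thm. 4.10] -/
theorem valueAtOneV_of_wAllExclAddWildRankOneSurj_of_poitouTate (hF : PublishedInputsWildThree)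
    (hPT : PoitouTateSelmerStructureDualityFact) (hPT2 : Theses.UniversalToricDescent.PoitouTateShaTateDualFact)
    (hZ : WildRankZeroTwistAtThree) (hleaf : Summit.BirchSwinnertonDyer.WAllExclAddWildRankOneSurj) :
    WildSplitEisensteinValueAtOneV := by
  intro W
  exact WildSplitEisensteinInclusionAtThreeTight.valueAtOneV_of_wAllExclAddWildRankOneSurj hF
    (wildSplitControlAtThree_of_poitouTate hPT hPT2) hZ hleaf W

/-! ### §5 Modulo the current `closes` binders + PT2: the rung ⟺ `E_𝟙^V` -/

/-- **Crux #2″ is EXACTLY the rung's residual given the Kolyvagin column and print.** Granted the route's current `closes`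
binders at face value — `PublishedInputsWildThree` (20389), `KolyvaginPrimitivesAtThree` (25896),
`JetchevMaxDivisibilityAtThreeModThree` (25897; in `closes` derived as `hGJ hPTc`), `WildSigmaDivisibilityAtThreeMultiCarrier`
(`J‴`, 25898), `WildSplitPrintedInputsAtThree` (W, 24476), `PoitouTateSelmerStructureDualityFact` (PT1, 20461; in `closes`
derived from 23092), `WildRankZeroTwistAtThree` (Z, 20387) — plus PT2: `WAllExclAddWildRankOneSurj ⟺ WildSplitEisensteinValueAtOneV`.
⇐ is the landed kernel-V (p609065 §3, = the closer p613203 of item 26611 ✓) by name; ⇒ is §4 (uses only PUB, PT1, PT2, Z of the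
list). CONDITIONAL on every listed package (`J‴`, Z research-open; the rest print); nothing asserted about any curve.
[cite: JetchevSkinnerWan2017, Thm. 3.3.1 and §7.4.1 (arXiv:1512.06894 pp. 11, 30)] [cite: McCallumLMS1991, §3]
[cite: GrossLMS1991, Prop. 3.7(2) and §6] [cite: Jetchev2008, Thm. 1.4] -/
theorem wAllExclAddWildRankOneSurj_iff_valueAtOneV_of_binders (hF : PublishedInputsWildThree)
    (hPr : KolyvaginPrimitivesAtThree) (hJmax : JetchevMaxDivisibilityAtThreeModThree)
    (hJ : WildSigmaDivisibilityAtThreeMultiCarrier) (hW : WildSplitPrintedInputsAtThree)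
    (hPT : PoitouTateSelmerStructureDualityFact) (hPT2 : Theses.UniversalToricDescent.PoitouTateShaTateDualFact)
    (hZ : WildRankZeroTwistAtThree) :
    Summit.BirchSwinnertonDyer.WAllExclAddWildRankOneSurj ↔ WildSplitEisensteinValueAtOneV :=
  ⟨valueAtOneV_of_wAllExclAddWildRankOneSurj_of_poitouTate hF hPT hPT2 hZ,
    fun hE1V ↦ EisensteinKernelAtThreeOfValueAtOneV.wAllExclAddWildRankOneSurj_of_valueAtOneV_of_sigmaMultiCarrier_of_jetchevMaxModThree_of_primitives_of_poitouTate
      hF hE1V hPr hJmax hJ hW hPT hZ⟩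

/-! ### §6 The same pair in INDEX currency: leaf → PUB → Z → `L₃ʷ°`; modulo {PUB, Prims, Jetchev max-form, J‴, PT1, Z}: leaf ⟺ `L₃ʷ°` -/

/-- **`L₃ʷ°` is implied by the leaf: `PublishedInputsWildThree → WildRankZeroTwistAtThree → WAllExclAddWildRankOneSurj → L₃ʷ°`.**
At every odd Friedberg–Hoffstein datum of the cell: the leaf gives `BSD₃(E)` (`E` non-CM since `ρ̄₃` is onto), Z gives `BSD₃`
of a globally minimal model of `E^{(d_K)}` (an O6 row of analytic rank `0`, `classO6_twist_of_heegner`), and soed-p2 g2's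
`WildKolyvaginUpperAtThreeTight.indexBounds_of_bsdp_of_partner_bsdp` (Gross–Zagier over `ℚ` twice + GZ86 I.(7.3) + Kolyvagin)
returns BOTH sockets at slack `v₃(c)`; keep the lower one. No frame, no control theorem, no Poitou–Tate: necessity in index
currency costs PUB + Z only. (This is the first half of `Tight.valueAtOneV_of_wAllExclAddWildRankOneSurj`, isolated.)
CONDITIONAL; nothing asserted about any curve. [cite: GrossZagier1986, Thm. I.(6.3) and (7.3)]
[cite: JetchevSkinnerWan2017, §7.4.1 (arXiv:1512.06894 p. 30)] -/
theorem stepL_of_wAllExclAddWildRankOneSurj (hF : PublishedInputsWildThree) (hZ : WildRankZeroTwistAtThree)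
    (hleaf : Summit.BirchSwinnertonDyer.WAllExclAddWildRankOneSurj) :
    ∀ (W : WeierstrassCurve ℚ) [W.IsElliptic] [W.IsGloballyMinimal] (N : ℕ) [NeZero N] (K : Type) [Field K]
      [NumberField K] (Dt : ModularParametrizationData W N) (H : HeegnerDatum N (NumberField.discr K)) (ι : K →+* ℂ)
      (P : (W.baseChange K).toAffine.Point), ClassO6 W 3 → W.HasSurjectiveModNGaloisRep 3 → W.analyticRank = 1 →
      W.conductorNorm ℤ = N → IsImaginaryQuadratic K → SatisfiesHeegnerHypothesis N K →
      (W.quadraticTwist (NumberField.discr K : ℚ)).entireLFunction 1 ≠ 0 →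
      WeierstrassCurve.Affine.Point.map ι.toRatAlgHom P = heegnerPointComplex Dt H → ¬ IsOfFinAddOrder P →
      Odd (NumberField.discr K) → SchneiderFree.IndexLowerBoundLeAt W 3 K P (padicValNat 3 Dt.c.natAbs) := by
  intro W _ _ N _ K _ _ Dt H ι P hO6 hsurj hr hN hK hHH hLt hP _hnt hodd
  obtain ⟨hGZ, hKo, hGZK, hmod, -, -, hGZ73, -, -, -⟩ := hF
  haveI : Fact (Nat.Prime 3) := ⟨Nat.prime_three⟩
  -- the leaf: `BSD₃(E)` (`E` is non-CM since `ρ̄₃` is onto)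
  have hCM : ¬ W.HasCM := fun hCM ↦
    W.not_hasSurjectiveModNGaloisRep_of_hasCM hCM Nat.prime_three (by decide) hsurj
  have hWB : BSDp W 3 := hleaf W hCM hO6 hsurj hr
  -- the residual Z: `BSD₃` of a globally minimal model of the twist (an O6 row of analytic rank `0`)
  have hZ' : Summit.BirchSwinnertonDyer.WAllExclAddWildRankZero := hZ
  have hD0 : (NumberField.discr K : ℚ) ≠ 0 := by exact_mod_cast NumberField.discr_ne_zero K
  haveI : (W.quadraticTwist (NumberField.discr K : ℚ)).IsElliptic := W.isElliptic_quadraticTwist hD0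
  obtain ⟨Cd, hCd⟩ := hasGlobalMinimalModel_rat_holds (W.quadraticTwist (NumberField.discr K : ℚ))
  haveI : (Cd • W.quadraticTwist (NumberField.discr K : ℚ)).IsGloballyMinimal := hCd
  have hHN' : SatisfiesHeegnerHypothesis (W.conductorNorm ℤ) K := by rw [hN]; exact hHH
  obtain ⟨hO6d, hjd⟩ := classO6_twist_of_heegner W hO6 K hK hHN' hodd
    (Cd • W.quadraticTwist (NumberField.discr K : ℚ)) Cd rfl
  have hCMd : ¬ (Cd • W.quadraticTwist (NumberField.discr K : ℚ)).HasCM := fun h ↦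
    hCM ((hasCM_iff_of_j_eq hjd).mp h)
  have hLd1 : (Cd • W.quadraticTwist (NumberField.discr K : ℚ)).entireLFunction 1 ≠ 0 := by
    rw [entireLFunction_smul]; exact hLt
  have hrd : (Cd • W.quadraticTwist (NumberField.discr K : ℚ)).analyticRank = 0 :=
    analyticRank_eq_zero_of_entireLFunction_one_ne_zero _ hLd1
  have hWdB : BSDp (Cd • W.quadraticTwist (NumberField.discr K : ℚ)) 3 := hZ' _ hCMd hO6d hrd
  -- `3 ∣ N` splits in `K`: `3 ∤ #𝓞_K^×`
  have h3N : 3 ∣ W.conductorNorm ℤ :=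
    (W.dvd_conductorNorm_iff_not_hasGoodReductionAtPrime 3).mpr (not_good_of_addv W 3 hO6.2.1)
  have hpN : 3 ∣ N := hN ▸ h3N
  have hw : ¬ 3 ∣ Units.torsionOrder K :=
    (X11b.Three.not_dvd_discr_and_not_dvd_torsionOrder_of_heegner hK hHH (by decide) hpN).2
  -- both sockets at slack `v₃(c)` from the two `BSD₃`'s; keep STEP L
  exact (WildKolyvaginUpperAtThreeTight.indexBounds_of_bsdp_of_partner_bsdp hGZ hKo hGZK hmod hGZ73 W 3 N K
    Dt H ι P (Cd • W.quadraticTwist (NumberField.discr K : ℚ)) hr hN hpN hK hodd hw hHH hLt hP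
    ⟨Cd, rfl⟩ (by decide) hWB hWdB).1

/-- **In index currency the rung-equivalence is `W`-free and PT2-free: granted {PUB 20389, Prims 25896, Jetchev max-form 25897,
`J‴` 25898, PT1 20461, Z 20387}, `WAllExclAddWildRankOneSurj ⟺ L₃ʷ°`.** ⇒ is `stepL_of_wAllExclAddWildRankOneSurj` (PUB + Z only);
⇐ is w3 g13's `W`-free kernel (p615634 §4). Compare §5: typing crux #2 as `E_𝟙^V` adds W (Hsieh Thm A ∧ BDP Thm 5.5 ∧ LZZ) to ⇐
and PT2 (+ PT1 on the `E`-side) to ⇒ — the exact trust-base difference between the two typings; the research content is the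
same (§3). CONDITIONAL on every listed package; nothing asserted about any curve; BSD₃ is proved for no curve.
[cite: JetchevSkinnerWan2017, §7.4.1 (arXiv:1512.06894 p. 30)] [cite: GrossZagier1986, Thm. I.(6.3) and V.§2]
[cite: FriedbergHoffstein1995, Thm. B] [cite: McCallumLMS1991, §3] [cite: Jetchev2008, Thm. 1.4] -/
theorem wAllExclAddWildRankOneSurj_iff_stepL_of_binders (hF : PublishedInputsWildThree)
    (hPr : KolyvaginPrimitivesAtThree) (hJmax : JetchevMaxDivisibilityAtThreeModThree)
    (hJ : WildSigmaDivisibilityAtThreeMultiCarrier) (hPT : PoitouTateSelmerStructureDualityFact)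
    (hZ : WildRankZeroTwistAtThree) :
    Summit.BirchSwinnertonDyer.WAllExclAddWildRankOneSurj ↔
      ∀ (W : WeierstrassCurve ℚ) [W.IsElliptic] [W.IsGloballyMinimal] (N : ℕ) [NeZero N] (K : Type) [Field K]
        [NumberField K] (Dt : ModularParametrizationData W N) (H : HeegnerDatum N (NumberField.discr K)) (ι : K →+* ℂ)
        (P : (W.baseChange K).toAffine.Point), ClassO6 W 3 → W.HasSurjectiveModNGaloisRep 3 → W.analyticRank = 1 →
        W.conductorNorm ℤ = N → IsImaginaryQuadratic K → SatisfiesHeegnerHypothesis N K →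
        (W.quadraticTwist (NumberField.discr K : ℚ)).entireLFunction 1 ≠ 0 →
        WeierstrassCurve.Affine.Point.map ι.toRatAlgHom P = heegnerPointComplex Dt H → ¬ IsOfFinAddOrder P →
        Odd (NumberField.discr K) → SchneiderFree.IndexLowerBoundLeAt W 3 K P (padicValNat 3 Dt.c.natAbs) :=
  ⟨stepL_of_wAllExclAddWildRankOneSurj hF hZ,
    fun hL ↦ WildSplitEisensteinValueAtOneVStepLNormalForm.wAllExclAddWildRankOneSurj_of_stepL_of_sigmaMultiCarrier_of_jetchevMaxModThree_of_primitives_of_poitouTate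
      hF hL hPr hJmax hJ hPT hZ⟩

end Summit.BirchSwinnertonDyer.BirchSwinnertonDyer.Theorems.WildSplitEisensteinValueAtOneVNecessityOfPrint

end
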